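import Literature.NumberTheory.DiophantineGeometry.GenEllImagePoints
import Mathlib.NumberTheory.RamificationInertia.Valuation
import HarnessLib

/-!
# Vojta's height inequality for `ℙ¹ ∖ {0,1,∞}` at degree `[K:ℚ]` gives abc for `K`-points

Companion PROOF file (theorems only) of `GenEllThm21` ([GenEll] Thm. 2.1 (i) for `(ℙ¹_ℚ, [0]+[1]+[∞])`,
`VojtaP1Deg d`): for a number field `K`, the inequality `ht ≲ (1+ε)(log-diff + log-cond)` on
`U_P(Q̄)^{≤ [K:ℚ]}` (points presented over their MINIMAL field, [GenEll] Def. 1.5 (i)) yields the abc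
inequality for every `x ∈ K ∖ {0, 1}` IN `K`-TERMS, the field entering only through a constant:

* `abc_numberField_of_vojtaP1Deg`: `∃ C, ∀ x ∈ K ∖ {0,1}`, for every finite set `T` of primes of `K`
  containing the bad primes of `(x : 1−x : 1)`,  `h_K(x) ≤ (1+ε) · Σ_{w ∈ T} log N(w) + C`
  (`h_K = logHeight₁`, Mathlib's logarithmic Weil height relative to `K`).

This is the classical remark that Vojta's conjecture for the thrice-punctured line at bounded degree
gives the abc conjecture over a fixed number field (Granville–Stark, Invent. Math. 139 (2000) §1:
"(1) does follow from Vojta's General Conjecture … under the additional assumption that `[K:ℚ]` is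
bounded"; Vojta, LNM 1239 (1987) §5). Proof: re-present `x` over its minimal field `ℚ(x) ⊆ K`
(`NFPoint.imageAt`, `imageAt_mem_UPle`, `ht_imageAt`), and transfer the conductor by the
conductor–different inequality `log-cond_{ℚ(x)} − log-cond_K ≤ log-diff_K − log-diff_{ℚ(x)}`
(`NFPoint.cond_sub_cond_le_logDiff_sub_logDiff`, [GenEll] Prop. 1.7 (i)), the bad primes of `x` in `K`
lying over those in `ℚ(x)` (Mathlib `valuation_liesOver`). No new definitions; classical.
-/

noncomputable section

open NumberField IsDedekindDomain Height Module

namespace Literature.NumberTheory.DiophantineGeometry.GenEll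

section Transfer

/-- A prime `w` of `K` over a bad prime of `(y : 1−y : 1)` in a subfield `F` is a bad prime of
`(y : 1−y : 1)` in `K` (valuations over `w` are `e`-th powers of valuations under it, Mathlib
`valuation_liesOver`; "`x` meets `C` at `w ∩ F` ⟹ `x` meets `C` at `w`").
[cite: MochizukiGenEll2010, Prop 1.7 (i) p.10] -/
theorem mem_badPrimes_of_under_mem {F K : Type*} [Field F] [NumberField F] [Field K] [NumberField K]
    [Algebra F K] (y : F) (w : HeightOneSpectrum (𝓞 K))
    (hw : w.under (𝓞 F) ∈ badPrimes y (1 - y) 1) :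
    w ∈ badPrimes (algebraMap F K y) (1 - algebraMap F K y) 1 := by
  set v := w.under (𝓞 F) with hv
  haveI : w.asIdeal.LiesOver v.asIdeal := ⟨rfl⟩
  have key : ∀ z : F, w.valuation K (algebraMap F K z) =
      v.valuation F z ^ v.asIdeal.ramificationIdx' w.asIdeal := fun z =>
    (IsDedekindDomain.HeightOneSpectrum.valuation_liesOver K v w z).symm
  have he : v.asIdeal.ramificationIdx' w.asIdeal ≠ 0 :=
    Ideal.IsDedekindDomain.ramificationIdx'_ne_zero_of_liesOver w.asIdeal v.ne_bot
  have hinj : ∀ a b : WithZero (Multiplicative ℤ),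
      a ^ v.asIdeal.ramificationIdx' w.asIdeal = b ^ v.asIdeal.ramificationIdx' w.asIdeal → a = b :=
    fun a b h => (pow_left_inj₀ zero_le zero_le he).mp h
  simp only [badPrimes, Set.mem_setOf_eq] at hw ⊢
  rw [show (1 : K) - algebraMap F K y = algebraMap F K (1 - y) by simp, key, key,
    show (1 : K) = algebraMap F K 1 from (map_one _).symm, key]
  intro h
  exact hw ⟨hinj _ _ h.1, hinj _ _ h.2⟩

open scoped Classical in
/-- **abc over `K` from Vojta's height inequality at degree `[K:ℚ]`** (Granville–Stark 2000 §1;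
Vojta LNM 1239 §5; via [GenEll] Def. 1.5 (i) / Prop. 1.7 (i)): if `VojtaP1Deg [K:ℚ]` holds then for
every `ε > 0` there is `C` such that for all `x ∈ K ∖ {0,1}` and every finite set `T` of primes of
`K` containing the bad primes of `(x : 1−x : 1)`, `h_K(x) ≤ (1+ε)·Σ_{w∈T} log N(w) + C`.
[cite: GranvilleStark2000, §1 (abc over K from Vojta's conjecture at bounded degree)] -/
theorem abc_numberField_of_vojtaP1Deg (K : Type) [Field K] [NumberField K]
    (hV : VojtaP1Deg (finrank ℚ K)) {ε : ℝ} (hε : 0 < ε) :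
    ∃ C : ℝ, ∀ x : K, x ≠ 0 → x ≠ 1 → ∀ T : Finset (HeightOneSpectrum (𝓞 K)),
      (∀ w, w ∈ badPrimes x (1 - x) 1 → w ∈ T) →
        logHeight₁ x ≤ (1 + ε) * ∑ w ∈ T, Real.log (Ideal.absNorm w.asIdeal : ℝ) + C := by
  obtain ⟨C₀, hC₀⟩ := hV ε hε
  refine ⟨(1 + ε) * Real.log ((discr K).natAbs : ℝ) + finrank ℚ K * C₀, fun x hx0 hx1 T hT => ?_⟩
  -- `x` presented over `K`, and re-presented over its minimal field `ℚ(x)`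
  set P₀ : NFPoint := ⟨K, x⟩ with hP₀
  set Q : NFPoint := P₀.imageAt x with hQ
  have hdeg₀ : P₀.degree = finrank ℚ K := rfl
  have hmem : Q ∈ Set.univ ∩ UPle (finrank ℚ K) :=
    ⟨Set.mem_univ _, P₀.imageAt_mem_UPle hx0 hx1 (hdeg₀ ▸ le_rfl)⟩
  have hineq := hC₀ Q hmem
  have hInU : Q.InU := (P₀.imageAt_inU_iff x).mpr ⟨hx0, hx1⟩
  have hht : Q.ht = (finrank ℚ K : ℝ)⁻¹ * logHeight₁ x := P₀.ht_imageAt x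
  have hdegK : (0 : ℝ) < finrank ℚ K := Nat.cast_pos.mpr finrank_pos
  -- the conductor–different inequality along `ℚ(x) ⊆ K`
  set S : Finset (HeightOneSpectrum (𝓞 Q.F)) := (Q.condSupport_finite hInU).toFinset with hS
  have hcond : Q.logCond = (Q.degree : ℝ)⁻¹ * ∑ v ∈ S, Real.log (Ideal.absNorm v.asIdeal : ℝ) :=
    Q.logCond_eq_sum hInU
  have hcd : (Q.degree : ℝ)⁻¹ * ∑ v ∈ S, Real.log (Ideal.absNorm v.asIdeal : ℝ) -
      (P₀.degree : ℝ)⁻¹ * ∑ w ∈ T, Real.log (Ideal.absNorm w.asIdeal : ℝ) ≤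
      P₀.logDiff - Q.logDiff := by
    refine NFPoint.cond_sub_cond_le_logDiff_sub_logDiff Q P₀ (P₀.imageEmb x) S T ?_
    letI : Algebra Q.F P₀.F := (P₀.imageEmb x).toAlgebra
    intro w hw
    apply hT
    have hw' : w.under (𝓞 Q.F) ∈ badPrimes Q.x (1 - Q.x) 1 := by
      rw [← NFPoint.condSupport_eq_badPrimes]
      exact (Q.condSupport_finite hInU).mem_toFinset.mp hw
    have h := mem_badPrimes_of_under_mem Q.x w hw'
    have hQx : algebraMap Q.F P₀.F Q.x = x := P₀.imageEmb_x x
    rwa [hQx] at h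
  have hlogDiff₀ : P₀.logDiff = (finrank ℚ K : ℝ)⁻¹ * Real.log ((discr K).natAbs : ℝ) :=
    P₀.logDiff_eq_log_discr
  -- assemble
  have h1 : Q.ht ≤ (1 + ε) * (Q.logDiff + Q.logCond) + C₀ := by
    have := hineq; simp only at this; linarith
  have h2 : Q.logDiff + Q.logCond ≤ (finrank ℚ K : ℝ)⁻¹ * Real.log ((discr K).natAbs : ℝ) +
      (finrank ℚ K : ℝ)⁻¹ * ∑ w ∈ T, Real.log (Ideal.absNorm w.asIdeal : ℝ) := by
    rw [hcond, ← hlogDiff₀, ← hdeg₀]; linarith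
  have h3 : (finrank ℚ K : ℝ)⁻¹ * logHeight₁ x ≤
      (1 + ε) * ((finrank ℚ K : ℝ)⁻¹ * Real.log ((discr K).natAbs : ℝ) +
        (finrank ℚ K : ℝ)⁻¹ * ∑ w ∈ T, Real.log (Ideal.absNorm w.asIdeal : ℝ)) + C₀ := by
    rw [← hht]
    have h1e : (0 : ℝ) ≤ 1 + ε := by linarith
    nlinarith [mul_le_mul_of_nonneg_left h2 h1e]
  have h4 := mul_le_mul_of_nonneg_left h3 hdegK.le
  have e1 : (finrank ℚ K : ℝ) * ((finrank ℚ K : ℝ)⁻¹ * logHeight₁ x) = logHeight₁ x := by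
    field_simp
  have e2 : (finrank ℚ K : ℝ) * ((1 + ε) * ((finrank ℚ K : ℝ)⁻¹ * Real.log ((discr K).natAbs : ℝ) +
      (finrank ℚ K : ℝ)⁻¹ * ∑ w ∈ T, Real.log (Ideal.absNorm w.asIdeal : ℝ)) + C₀) =
      (1 + ε) * ∑ w ∈ T, Real.log (Ideal.absNorm w.asIdeal : ℝ) +
        ((1 + ε) * Real.log ((discr K).natAbs : ℝ) + finrank ℚ K * C₀) := by
    field_simp
    ring
  rw [e1, e2] at h4
  exact h4

end Transfer

end Literature.NumberTheory.DiophantineGeometry.GenEll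

end
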